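import Summits.ValiantsHypothesis.ValiantsHypothesis.Theorems.LiftNullstellensatzLiftWidthPerFourCaseAEngine
import Summits.ValiantsHypothesis.ValiantsHypothesis.Theorems.LiftNullstellensatzLiftWidthPerFourCaseASubst
import Summits.ValiantsHypothesis.ValiantsHypothesis.Theorems.LiftNullstellensatzLiftWidthPerFourCaseATwoRow

/-!
# Route LiftNullstellensatz — `LiftWidthPerFour` (stmt-ValiantsHypothesis-5922), CASE A: the
SECTION REDUCTION — Case A for `(ℓ, ℓ')` from the engine facts on a linear section

Helper `--supports stmt-ValiantsHypothesis-5922` (prover val-width-5922-p2 g0; crux workfile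
`CASEA-RUNG1-p2.md` v2 §6).  Rows `0` (`x`), `3` (`ξ`), middle rows `1, 2`;
`ℓ = λ + Σ α_j x_j + Σ u_k ξ_k`, `ℓ' = λ' + Σ u'_j x_j + Σ β_k ξ_k`, `λ, λ'` linear in the middle rows,
`(λ, λ') ≠ (0, 0)` (the case `λ = λ' = 0` is `caseA_twoRow`).  If a substitution `θ : K[x] → K[τ]` by
linear forms kills the rows `0, 3`, the column `0` and `λ, λ'` (a parametrisation of the section
`W = Λ₀ ∩ V(λ, λ')`), and `q = (θp₂₃, θp₁₃, θp₁₂)` satisfies the ENGINE FACTS of `…CaseAEngine.lean`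
(`q 0 ≠ 0`, (F1) no linear syzygy, (F2) Koszul quadratic syzygies, (F3) `q 0 f = q 1 g ⇒ g = 0`), then
`per_4 ≠ Σ_{s<b} v_s v'_s` for `b ≤ 5`, `v_s ∈ (x, ℓ)₂`, `v'_s ∈ (ξ, ℓ')₂`.
Proof: `θ v_s = θ v'_s = 0`, `θ(∂_{ξ_k} v_s) = u_k θb_s`, `θ(∂_{x_j} v'_s) = u'_j θd_s`, so
`θ(∂_{x_j}∂_{ξ_k} per_4) = Σ_s θ(∂_{x_j}v_s) θ(∂_{ξ_k}v'_s) + u'_j u_k θΦ` with `Φ = Σ b̂_s d̂_s`; the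
correction dies since `λλ'Φ = κ₀(per_4) = 0`, or `λ u'_j Φ = κ₀(∂_{x_j} per_4) = 0` /
`λ' u_k Φ = κ₀(∂_{ξ_k} per_4) = 0` in the one-sided cases (`κ₀` = kill the two rows).  So linear
matrices factor `θ(∂²per_4) = [[0, qᵀ], [q, 0]]` (`…CaseASubst.lean`): blocks `ĀC̄ = 0`, `Āc = q`,
`aᵀC̄ = qᵀ`, refuted by `false_of_G1_blocks_of_facts`.  For REGULAR sections (F1), (F2) are inherited
from rung 1 (§6); the bad sections are val-width-5922-p1 g2's exceptional families.
No new definitions.  VP ≠ VNP is not moved by this item.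
-/

noncomputable section

open MvPolynomial Matrix Finset

namespace Summit.ValiantsHypothesis.LiftNullstellensatz

open Literature.Computability.AlgebraicComplexity
open Literature.Computability.AlgebraicComplexity.VonZurGathen

variable {K : Type*} [Field K]



/-! ### The section reduction (rows `0, 3`, killed column `0`) -/

/-- **CASE A from the engine facts on a linear section** (five products; rows `0, 3`, killed
column `0`; see the module docstring for the statement in words and the proof).
[cite: BlaserIkenmeyerMahajanPandeySaurabh2020, §2 (problem)] -/
theorem caseA_five_of_section_facts {τ : Type*}
    (θ : MvPolynomial (Fin 4 × Fin 4) K →ₐ[K] MvPolynomial τ K)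
    (hθ1 : ∀ w, (θ (X w)).IsHomogeneous 1)
    (hθ0 : ∀ j, θ (X (0, j)) = 0) (hθ3 : ∀ k, θ (X (3, k)) = 0) (hθc : ∀ r, θ (X (r, 0)) = 0)
    (μ ν μ' ν' α u u' β : Fin 4 → K)
    (hθlam : θ (∑ c, C (μ c) * X (1, c) + ∑ c, C (ν c) * X (2, c)) = 0)
    (hθlam' : θ (∑ c, C (μ' c) * X (1, c) + ∑ c, C (ν' c) * X (2, c)) = 0)
    (hnd : (∑ c, C (μ c) * X (1, c) + ∑ c, C (ν c) * X (2, c) :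
        MvPolynomial (Fin 4 × Fin 4) K) ≠ 0 ∨
      (∑ c, C (μ' c) * X (1, c) + ∑ c, C (ν' c) * X (2, c) :
        MvPolynomial (Fin 4 × Fin 4) K) ≠ 0)
    (q : Fin 3 → MvPolynomial τ K)
    (hq₀ : q 0 = θ (X (1, 2) * X (2, 3) + X (1, 3) * X (2, 2)))
    (hq₁ : q 1 = θ (X (1, 1) * X (2, 3) + X (1, 3) * X (2, 1)))
    (hq₂ : q 2 = θ (X (1, 1) * X (2, 2) + X (1, 2) * X (2, 1)))
    (hq0 : q 0 ≠ 0)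
    (hF1 : ∀ l₀ l₁ l₂ : MvPolynomial τ K, l₀.IsHomogeneous 1 → l₁.IsHomogeneous 1 →
      l₂.IsHomogeneous 1 → l₀ * q 0 + l₁ * q 1 + l₂ * q 2 = 0 → l₀ = 0 ∧ l₁ = 0 ∧ l₂ = 0)
    (hF2 : ∀ n₀ n₁ n₂ : MvPolynomial τ K, n₀.IsHomogeneous 2 → n₁.IsHomogeneous 2 →
      n₂.IsHomogeneous 2 → n₀ * q 0 + n₁ * q 1 + n₂ * q 2 = 0 → ∃ lam mu nu : K,
        n₀ = C lam * q 1 + C mu * q 2 ∧ n₁ = -(C lam * q 0) + C nu * q 2 ∧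
        n₂ = -(C mu * q 0) - C nu * q 1)
    (hF3 : ∀ f g : MvPolynomial τ K, f.IsHomogeneous 1 → g.IsHomogeneous 1 →
      q 0 * f = q 1 * g → g = 0)
    (v v' : Fin 5 → MvPolynomial (Fin 4 × Fin 4) K)
    (hv : ∀ s, v s ∈ Ideal.span (insert
      ((∑ c, C (μ c) * X (1, c) + ∑ c, C (ν c) * X (2, c)) + ∑ j, C (α j) * X (0, j) +
        ∑ k, C (u k) * X (3, k) : MvPolynomial (Fin 4 × Fin 4) K)
      (Set.range fun j : Fin 4 => (X (0, j) : MvPolynomial (Fin 4 × Fin 4) K))))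
    (hv2 : ∀ s, (v s).IsHomogeneous 2)
    (hv' : ∀ s, v' s ∈ Ideal.span (insert
      ((∑ c, C (μ' c) * X (1, c) + ∑ c, C (ν' c) * X (2, c)) + ∑ j, C (u' j) * X (0, j) +
        ∑ k, C (β k) * X (3, k) : MvPolynomial (Fin 4 × Fin 4) K)
      (Set.range fun k : Fin 4 => (X (3, k) : MvPolynomial (Fin 4 × Fin 4) K))))
    (hv'2 : ∀ s, (v' s).IsHomogeneous 2) :
    perPoly (Fin 4) K ≠ ∑ s, v s * v' s := by
  classical
  intro hper
  set lam : MvPolynomial (Fin 4 × Fin 4) K := ∑ c, C (μ c) * X (1, c) + ∑ c, C (ν c) * X (2, c) with hlam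
  set lam' : MvPolynomial (Fin 4 × Fin 4) K := ∑ c, C (μ' c) * X (1, c) + ∑ c, C (ν' c) * X (2, c) with hlam'
  set ℓ : MvPolynomial (Fin 4 × Fin 4) K := lam + ∑ j, C (α j) * X (0, j) + ∑ k, C (u k) * X (3, k) with hℓ
  set ℓ' : MvPolynomial (Fin 4 × Fin 4) K := lam' + ∑ j, C (u' j) * X (0, j) + ∑ k, C (β k) * X (3, k) with hℓ'
  -- homogeneity of the generators
  have hlin : ∀ (a : Fin 4 → K) (r : Fin 4),
      (∑ j, C (a j) * X (r, j) : MvPolynomial (Fin 4 × Fin 4) K).IsHomogeneous 1 := fun a r =>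
    IsHomogeneous.sum _ _ _ fun j _ => (isHomogeneous_X K (r, j)).C_mul (a j)
  have hℓ1 : ℓ.IsHomogeneous 1 := (((hlin μ 1).add (hlin ν 2)).add (hlin α 0)).add (hlin u 3)
  have hℓ'1 : ℓ'.IsHomogeneous 1 := (((hlin μ' 1).add (hlin ν' 2)).add (hlin u' 0)).add (hlin β 3)
  -- Step A: linear coefficient vectors
  set Xh : Fin 5 → MvPolynomial (Fin 4 × Fin 4) K := Fin.cons ℓ (fun j : Fin 4 => (X (0, j) : MvPolynomial (Fin 4 × Fin 4) K)) with hXh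
  set Ξh : Fin 5 → MvPolynomial (Fin 4 × Fin 4) K := Fin.cons ℓ' (fun k : Fin 4 => (X (3, k) : MvPolynomial (Fin 4 × Fin 4) K)) with hΞh
  have hXh1 : ∀ i, (Xh i).IsHomogeneous 1 := fun i => by
    refine Fin.cases ?_ (fun j => ?_) i
    · simpa [hXh] using hℓ1
    · simpa [hXh] using isHomogeneous_X K ((0 : Fin 4), j)
  have hΞh1 : ∀ i, (Ξh i).IsHomogeneous 1 := fun i => by
    refine Fin.cases ?_ (fun k => ?_) i
    · simpa [hΞh] using hℓ'1
    · simpa [hΞh] using isHomogeneous_X K ((3 : Fin 4), k)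
  have hrange : Set.range Xh = insert ℓ (Set.range fun j : Fin 4 => (X (0, j) : MvPolynomial (Fin 4 × Fin 4) K)) := by rw [hXh, Fin.range_cons]
  have hrange' : Set.range Ξh = insert ℓ' (Set.range fun k : Fin 4 => (X (3, k) : MvPolynomial (Fin 4 × Fin 4) K)) := by rw [hΞh, Fin.range_cons]
  have hc : ∀ s, ∃ c : Fin 5 → MvPolynomial (Fin 4 × Fin 4) K, (∀ i, (c i).IsHomogeneous 1) ∧ v s = ∑ i, Xh i * c i := fun s =>
    exists_linear_coeffs_of_mem_span Xh hXh1 (hv2 s) (by rw [hrange]; exact hv s)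
  have hc' : ∀ s, ∃ c : Fin 5 → MvPolynomial (Fin 4 × Fin 4) K, (∀ i, (c i).IsHomogeneous 1) ∧ v' s = ∑ i, Ξh i * c i := fun s =>
    exists_linear_coeffs_of_mem_span Ξh hΞh1 (hv'2 s) (by rw [hrange']; exact hv' s)
  choose c hc1 hcv using hc
  choose c' hc'1 hc'v using hc'
  -- Step B: the substitutions θ (section) and κ₀ (kill the two rows)
  set gθ : Fin 4 × Fin 4 → MvPolynomial τ K := fun w => θ (X w) with hgθ
  have hθg : θ = aeval gθ := MvPolynomial.aeval_unique θ
  set g₀ : Fin 4 × Fin 4 → MvPolynomial (Fin 4 × Fin 4) K := fun w => if w.1 = 0 ∨ w.1 = 3 then 0 else X w with hg₀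
  set κ : MvPolynomial (Fin 4 × Fin 4) K →ₐ[K] MvPolynomial (Fin 4 × Fin 4) K := aeval g₀ with hκ
  have hκX0 : ∀ j, κ (X (0, j)) = 0 := fun j => by rw [hκ, aeval_X, hg₀]; simp
  have hκX3 : ∀ k, κ (X (3, k)) = 0 := fun k => by rw [hκ, aeval_X, hg₀]; simp
  have h10 : ¬((1 : Fin 4) = 0 ∨ (1 : Fin 4) = 3) := by decide
  have h20 : ¬((2 : Fin 4) = 0 ∨ (2 : Fin 4) = 3) := by decide
  have hκX1 : ∀ c, κ (X (1, c)) = X (1, c) := fun c => by rw [hκ, aeval_X]; exact if_neg h10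
  have hκX2 : ∀ c, κ (X (2, c)) = X (2, c) := fun c => by rw [hκ, aeval_X]; exact if_neg h20
  have hκlam : κ lam = lam := by simp [hlam, map_add, map_sum, map_mul, hκX1, hκX2]
  have hκlam' : κ lam' = lam' := by simp [hlam', map_add, map_sum, map_mul, hκX1, hκX2]
  have hκℓ : κ ℓ = lam := by simp [hℓ, map_add, map_sum, map_mul, hκX0, hκX3, hκlam]
  have hκℓ' : κ ℓ' = lam' := by simp [hℓ', map_add, map_sum, map_mul, hκX0, hκX3, hκlam']
  have hθℓ : θ ℓ = 0 := by simp [hℓ, map_add, map_sum, map_mul, hθ0, hθ3, hθlam]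
  have hθℓ' : θ ℓ' = 0 := by simp [hℓ', map_add, map_sum, map_mul, hθ0, hθ3, hθlam']
  have hθκ : ∀ f, θ (κ f) = θ f := fun f => by
    have hcomp : θ.comp κ = θ := by
      refine MvPolynomial.algHom_ext fun w => ?_
      rw [AlgHom.comp_apply, hκ, aeval_X]
      rcases w with ⟨r, cc⟩
      by_cases h : r = 0 ∨ r = 3
      · have hg : g₀ (r, cc) = 0 := if_pos h
        rw [hg, map_zero]; rcases h with rfl | rfl; exacts [(hθ0 cc).symm, (hθ3 cc).symm]
      · have hg : g₀ (r, cc) = X (r, cc) := if_neg h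
        rw [hg]
    exact congrArg (fun φ : MvPolynomial (Fin 4 × Fin 4) K →ₐ[K] MvPolynomial τ K => φ f) hcomp
  have hθXh : ∀ i, θ (Xh i) = 0 := fun i => by
    refine Fin.cases ?_ (fun j => ?_) i
    · simpa [hXh] using hθℓ
    · simpa [hXh] using hθ0 j
  have hθΞh : ∀ i, θ (Ξh i) = 0 := fun i => by
    refine Fin.cases ?_ (fun k => ?_) i
    · simpa [hΞh] using hθℓ'
    · simpa [hΞh] using hθ3 k
  have hκXh : ∀ i, κ (Xh i) = if i = 0 then lam else 0 := fun i => by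
    refine Fin.cases ?_ (fun j => ?_) i
    · simpa [hXh] using hκℓ
    · simpa [hXh, Fin.succ_ne_zero] using hκX0 j
  have hκΞh : ∀ i, κ (Ξh i) = if i = 0 then lam' else 0 := fun i => by
    refine Fin.cases ?_ (fun k => ?_) i
    · simpa [hΞh] using hκℓ'
    · simpa [hΞh, Fin.succ_ne_zero] using hκX3 k
  have hθv : ∀ s, θ (v s) = 0 := fun s => by
    rw [hcv s, map_sum]
    exact Finset.sum_eq_zero fun i _ => by rw [map_mul, hθXh, zero_mul]
  have hθv' : ∀ s, θ (v' s) = 0 := fun s => by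
    rw [hc'v s, map_sum]
    exact Finset.sum_eq_zero fun i _ => by rw [map_mul, hθΞh, zero_mul]
  -- the κ₀-parts of the ℓ-, ℓ'-coefficients
  set bh : Fin 5 → MvPolynomial (Fin 4 × Fin 4) K := fun s => κ (c s 0) with hbh
  set dh : Fin 5 → MvPolynomial (Fin 4 × Fin 4) K := fun s => κ (c' s 0) with hdh
  have hκv : ∀ s, κ (v s) = lam * bh s := fun s => by
    rw [hcv s, map_sum]
    simp only [map_mul, hκXh]
    rw [Fin.sum_univ_succ]
    simp [hbh]
  have hκv' : ∀ s, κ (v' s) = lam' * dh s := fun s => by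
    rw [hc'v s, map_sum]
    simp only [map_mul, hκΞh]
    rw [Fin.sum_univ_succ]
    simp [hdh]
  -- derivatives of the generators across the rows
  have hdℓ : ∀ k, pderiv (3, k) ℓ = C (u k) := fun k => by
    simp [hℓ, hlam, map_add, map_sum, Derivation.leibniz, pderiv_X, Pi.single_apply]
  have hdℓ' : ∀ j, pderiv (0, j) ℓ' = C (u' j) := fun j => by
    simp [hℓ', hlam', map_add, map_sum, Derivation.leibniz, pderiv_X, Pi.single_apply]
  have hdXh : ∀ k i, pderiv (3, k) (Xh i) = if i = 0 then C (u k) else 0 := fun k i => by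
    refine Fin.cases ?_ (fun j => ?_) i
    · simp [hXh, hdℓ]
    · have hne : (((0 : Fin 4), j) : Fin 4 × Fin 4) ≠ (3, k) := fun h => by
        simpa using (Prod.mk.inj h).1
      simp [hXh, pderiv_X, hne, Fin.succ_ne_zero]
  have hdΞh : ∀ j i, pderiv (0, j) (Ξh i) = if i = 0 then C (u' j) else 0 := fun j i => by
    refine Fin.cases ?_ (fun k => ?_) i
    · simp [hΞh, hdℓ']
    · have hne : (((3 : Fin 4), k) : Fin 4 × Fin 4) ≠ (0, j) := fun h => by
        simpa using (Prod.mk.inj h).1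
      simp [hΞh, pderiv_X, hne, Fin.succ_ne_zero]
  have F3θ : ∀ s k, θ (pderiv (3, k) (v s)) = C (u k) * θ (c s 0) := fun s k => by
    rw [hcv s, map_sum, map_sum]
    simp only [Derivation.leibniz, smul_eq_mul, map_add, map_mul, hθXh, zero_mul, zero_add, hdXh]
    rw [Fin.sum_univ_succ]
    simp [mul_comm]
  have F4θ : ∀ s j, θ (pderiv (0, j) (v' s)) = C (u' j) * θ (c' s 0) := fun s j => by
    rw [hc'v s, map_sum, map_sum]
    simp only [Derivation.leibniz, smul_eq_mul, map_add, map_mul, hθΞh, zero_mul, zero_add, hdΞh]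
    rw [Fin.sum_univ_succ]
    simp [mul_comm]
  have F3κ : ∀ s k, κ (pderiv (3, k) (v s)) = lam * κ (pderiv (3, k) (c s 0)) + C (u k) * bh s := fun s k => by
    rw [hcv s, map_sum, map_sum]
    simp only [Derivation.leibniz, smul_eq_mul, map_add, map_mul, hκXh, hdXh]
    rw [Fin.sum_univ_succ]
    simp [hbh, mul_comm]
  have F4κ : ∀ s j, κ (pderiv (0, j) (v' s)) = lam' * κ (pderiv (0, j) (c' s 0)) + C (u' j) * dh s := fun s j => by
    rw [hc'v s, map_sum, map_sum]
    simp only [Derivation.leibniz, smul_eq_mul, map_add, map_mul, hκΞh, hdΞh]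
    rw [Fin.sum_univ_succ]
    simp [hdh, mul_comm]
  -- Step C: the correction term φ·u'uᵀ vanishes
  set Φ : MvPolynomial (Fin 4 × Fin 4) K := ∑ s, bh s * dh s with hΦ
  have hθΦ : θ Φ = ∑ s, θ (c s 0) * θ (c' s 0) := by
    rw [hΦ, map_sum]
    exact Finset.sum_congr rfl fun s _ => by rw [map_mul, hbh, hdh]; simp only [hθκ]
  have hκper : κ (perPoly (Fin 4) K) = 0 := by
    rw [perPoly_eq_sum_X_mul_pderiv_row (K := K) (0 : Fin 4), map_sum]
    exact Finset.sum_eq_zero fun j _ => by rw [map_mul, hκX0, zero_mul]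
  have hκdper0 : ∀ j, κ (pderiv (0, j) (perPoly (Fin 4) K)) = 0 := fun j => by
    rw [pderiv_perPoly, hκ, aeval_subperm_X]
    exact Matrix.subperm_eq_zero_of_row _ 3 (by decide) fun i _ => by simp [hg₀]
  have hκdper3 : ∀ k, κ (pderiv (3, k) (perPoly (Fin 4) K)) = 0 := fun k => by
    rw [pderiv_perPoly, hκ, aeval_subperm_X]
    exact Matrix.subperm_eq_zero_of_row _ 0 (by decide) fun i _ => by simp [hg₀]
  have hφ : ∀ j k, (C (u' j) * C (u k) : MvPolynomial τ K) * θ Φ = 0 := by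
    intro j k
    by_cases hu : u = 0
    · simp [hu]
    by_cases hu' : u' = 0
    · simp [hu']
    suffices hΦ0 : Φ = 0 by rw [hΦ0, map_zero, mul_zero]
    obtain ⟨j₀, hj₀⟩ : ∃ j₀, u' j₀ ≠ 0 := by by_contra h; push Not at h; exact hu' (funext h)
    obtain ⟨k₀, hk₀⟩ : ∃ k₀, u k₀ ≠ 0 := by by_contra h; push Not at h; exact hu (funext h)
    by_cases hl : lam = 0
    · -- one-sided: λ = 0, λ' ≠ 0; use κ₀ ∂_{ξ_{k₀}}
      have hl' : lam' ≠ 0 := hnd.resolve_left (fun h => h hl)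
      have e := congrArg (fun f => κ (pderiv (3, k₀) f)) hper
      simp only [hκdper3, map_sum, Derivation.leibniz, smul_eq_mul, map_add, map_mul, hκv, hκv',
        F3κ, hl, zero_mul] at e
      -- e : 0 = Σ_s lam' * dh s * (C (u k₀) * bh s)
      have e' : lam' * C (u k₀) * Φ = 0 := by
        rw [hΦ, Finset.mul_sum, e]
        exact Finset.sum_congr rfl fun s _ => by ring
      exact (mul_eq_zero.1 e').resolve_left (mul_ne_zero hl' (C_ne_zero.2 hk₀))
    by_cases hl' : lam' = 0
    · -- one-sided: λ' = 0, λ ≠ 0; use κ₀ ∂_{x_{j₀}}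
      have e := congrArg (fun f => κ (pderiv (0, j₀) f)) hper
      simp only [hκdper0, map_sum, Derivation.leibniz, smul_eq_mul, map_add, map_mul, hκv, hκv',
        F4κ, hl', zero_mul, add_zero] at e
      have e' : lam * C (u' j₀) * Φ = 0 := by
        rw [hΦ, Finset.mul_sum, e]
        exact Finset.sum_congr rfl fun s _ => by ring
      exact (mul_eq_zero.1 e').resolve_left (mul_ne_zero hl (C_ne_zero.2 hj₀))
    · -- both λ, λ' ≠ 0; use κ₀ itself
      have e := congrArg κ hper
      simp only [hκper, map_sum, map_mul, hκv, hκv'] at e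
      have e' : lam * lam' * Φ = 0 := by
        rw [hΦ, Finset.mul_sum, e]
        exact Finset.sum_congr rfl fun s _ => by ring
      exact (mul_eq_zero.1 e').resolve_left (mul_ne_zero hl hl')
  -- Step D: the key identity  Σ_s θ(∂_{0j} v_s) θ(∂_{3k} v'_s) = θ(∂_{0j} ∂_{3k} per)
  have key : ∀ j k : Fin 4, ∑ s, θ (pderiv (0, j) (v s)) * θ (pderiv (3, k) (v' s)) =
      aeval gθ (pderiv (0, j) (pderiv (3, k) (perPoly (Fin 4) K))) := by
    intro j k
    rw [← hθg, hper, map_sum, map_sum, map_sum]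
    have step : ∀ s, θ (pderiv (0, j) (pderiv (3, k) (v s * v' s))) =
        θ (pderiv (0, j) (v s)) * θ (pderiv (3, k) (v' s)) +
          C (u' j) * C (u k) * (θ (c s 0) * θ (c' s 0)) := fun s => by
      simp only [Derivation.leibniz, smul_eq_mul, map_add, map_mul, hθv, hθv', F3θ, F4θ, zero_mul,
        zero_add]
      ring
    rw [Finset.sum_congr rfl fun s _ => step s, Finset.sum_add_distrib, ← Finset.mul_sum, ← hθΦ,
      hφ, add_zero]
  -- Step E: the bordered blocks, and the engine
  have hA : ∀ (j : Fin 4) s, (θ (pderiv (0, j) (v s))).IsHomogeneous 1 := fun j s => by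
    rw [hθg]; exact isHomogeneous_aeval_of_forall gθ hθ1 (by simpa using (hv2 s).pderiv (i := (0, j)))
  have hC : ∀ (k : Fin 4) s, (θ (pderiv (3, k) (v' s))).IsHomogeneous 1 := fun k s => by
    rw [hθg]; exact isHomogeneous_aeval_of_forall gθ hθ1 (by simpa using (hv'2 s).pderiv (i := (3, k)))
  have hgc : ∀ r, gθ (r, 0) = 0 := fun r => hθc r
  have hq' : ∀ {b' d : Fin 4}, gθ (1, b') * gθ (2, d) + gθ (1, d) * gθ (2, b') =
      θ (X (1, b') * X (2, d) + X (1, d) * X (2, b')) := fun {b' d} => by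
    simp [hgθ, map_add, map_mul]
  refine false_of_G1_blocks_of_facts q hq0 hF1 hF2 hF3
    (Matrix.of fun i s => θ (pderiv (0, i.succ) (v s)))
    (Matrix.of fun s i => θ (pderiv (3, i.succ) (v' s))) (fun s => θ (pderiv (0, 0) (v s)))
    (fun s => θ (pderiv (3, 0) (v' s))) (fun i s => hA _ _) (fun s i => hC _ _) ?_ ?_ ?_
  · refine Matrix.ext fun i i' => ?_
    rw [Matrix.mul_apply, Matrix.zero_apply]
    simp only [Matrix.of_apply]
    rw [key]
    exact aeval_pderiv_pderiv_perPoly_eq_zero gθ hgc (Fin.succ_ne_zero i) (Fin.succ_ne_zero i')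
  · funext i
    simp only [Matrix.mulVec, dotProduct, Matrix.of_apply]
    rw [key]
    fin_cases i
    · show aeval gθ (pderiv (0, 1) (pderiv (3, 0) (perPoly (Fin 4) K))) = q 0
      rw [hq₀, ← hq']
      exact aeval_pderiv_pderiv_perPoly_eq_perm' gθ (k := 1) (b := 2) (d := 3) (by decide) (by decide)
        (by decide) (by decide) (by decide) (by decide)
    · show aeval gθ (pderiv (0, 2) (pderiv (3, 0) (perPoly (Fin 4) K))) = q 1
      rw [hq₁, ← hq']
      exact aeval_pderiv_pderiv_perPoly_eq_perm' gθ (k := 2) (b := 1) (d := 3) (by decide) (by decide)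
        (by decide) (by decide) (by decide) (by decide)
    · show aeval gθ (pderiv (0, 3) (pderiv (3, 0) (perPoly (Fin 4) K))) = q 2
      rw [hq₂, ← hq']
      exact aeval_pderiv_pderiv_perPoly_eq_perm' gθ (k := 3) (b := 1) (d := 2) (by decide) (by decide)
        (by decide) (by decide) (by decide) (by decide)
  · funext i
    simp only [Matrix.vecMul, dotProduct, Matrix.of_apply]
    rw [key]
    fin_cases i
    · show aeval gθ (pderiv (0, 0) (pderiv (3, 1) (perPoly (Fin 4) K))) = q 0
      rw [hq₀, ← hq']
      exact aeval_pderiv_pderiv_perPoly_eq_perm gθ (k := 1) (b := 2) (d := 3) (by decide) (by decide)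
        (by decide) (by decide) (by decide) (by decide)
    · show aeval gθ (pderiv (0, 0) (pderiv (3, 2) (perPoly (Fin 4) K))) = q 1
      rw [hq₁, ← hq']
      exact aeval_pderiv_pderiv_perPoly_eq_perm gθ (k := 2) (b := 1) (d := 3) (by decide) (by decide)
        (by decide) (by decide) (by decide) (by decide)
    · show aeval gθ (pderiv (0, 0) (pderiv (3, 3) (perPoly (Fin 4) K))) = q 2
      rw [hq₂, ← hq']
      exact aeval_pderiv_pderiv_perPoly_eq_perm gθ (k := 3) (b := 1) (d := 2) (by decide) (by decide)
        (by decide) (by decide) (by decide) (by decide)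

/-- **The section reduction for `b ≤ 5` products** (padding with zero quadrics). [folklore] -/
theorem caseA_of_section_facts {τ : Type*}
    (θ : MvPolynomial (Fin 4 × Fin 4) K →ₐ[K] MvPolynomial τ K)
    (hθ1 : ∀ w, (θ (X w)).IsHomogeneous 1)
    (hθ0 : ∀ j, θ (X (0, j)) = 0) (hθ3 : ∀ k, θ (X (3, k)) = 0) (hθc : ∀ r, θ (X (r, 0)) = 0)
    (μ ν μ' ν' α u u' β : Fin 4 → K)
    (hθlam : θ (∑ c, C (μ c) * X (1, c) + ∑ c, C (ν c) * X (2, c)) = 0)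
    (hθlam' : θ (∑ c, C (μ' c) * X (1, c) + ∑ c, C (ν' c) * X (2, c)) = 0)
    (hnd : (∑ c, C (μ c) * X (1, c) + ∑ c, C (ν c) * X (2, c) :
        MvPolynomial (Fin 4 × Fin 4) K) ≠ 0 ∨
      (∑ c, C (μ' c) * X (1, c) + ∑ c, C (ν' c) * X (2, c) :
        MvPolynomial (Fin 4 × Fin 4) K) ≠ 0)
    (q : Fin 3 → MvPolynomial τ K)
    (hq₀ : q 0 = θ (X (1, 2) * X (2, 3) + X (1, 3) * X (2, 2)))
    (hq₁ : q 1 = θ (X (1, 1) * X (2, 3) + X (1, 3) * X (2, 1)))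
    (hq₂ : q 2 = θ (X (1, 1) * X (2, 2) + X (1, 2) * X (2, 1)))
    (hq0 : q 0 ≠ 0)
    (hF1 : ∀ l₀ l₁ l₂ : MvPolynomial τ K, l₀.IsHomogeneous 1 → l₁.IsHomogeneous 1 →
      l₂.IsHomogeneous 1 → l₀ * q 0 + l₁ * q 1 + l₂ * q 2 = 0 → l₀ = 0 ∧ l₁ = 0 ∧ l₂ = 0)
    (hF2 : ∀ n₀ n₁ n₂ : MvPolynomial τ K, n₀.IsHomogeneous 2 → n₁.IsHomogeneous 2 →
      n₂.IsHomogeneous 2 → n₀ * q 0 + n₁ * q 1 + n₂ * q 2 = 0 → ∃ lam mu nu : K,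
        n₀ = C lam * q 1 + C mu * q 2 ∧ n₁ = -(C lam * q 0) + C nu * q 2 ∧
        n₂ = -(C mu * q 0) - C nu * q 1)
    (hF3 : ∀ f g : MvPolynomial τ K, f.IsHomogeneous 1 → g.IsHomogeneous 1 →
      q 0 * f = q 1 * g → g = 0)
    (b : ℕ) (hb : b ≤ 5) (v v' : Fin b → MvPolynomial (Fin 4 × Fin 4) K)
    (hv : ∀ s, v s ∈ Ideal.span (insert
      ((∑ c, C (μ c) * X (1, c) + ∑ c, C (ν c) * X (2, c)) + ∑ j, C (α j) * X (0, j) +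
        ∑ k, C (u k) * X (3, k) : MvPolynomial (Fin 4 × Fin 4) K)
      (Set.range fun j : Fin 4 => (X (0, j) : MvPolynomial (Fin 4 × Fin 4) K))))
    (hv2 : ∀ s, (v s).IsHomogeneous 2)
    (hv' : ∀ s, v' s ∈ Ideal.span (insert
      ((∑ c, C (μ' c) * X (1, c) + ∑ c, C (ν' c) * X (2, c)) + ∑ j, C (u' j) * X (0, j) +
        ∑ k, C (β k) * X (3, k) : MvPolynomial (Fin 4 × Fin 4) K)
      (Set.range fun k : Fin 4 => (X (3, k) : MvPolynomial (Fin 4 × Fin 4) K))))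
    (hv'2 : ∀ s, (v' s).IsHomogeneous 2) :
    perPoly (Fin 4) K ≠ ∑ s, v s * v' s := by
  classical
  intro hper
  let V : Fin 5 → MvPolynomial (Fin 4 × Fin 4) K := fun t => if h : (t : ℕ) < b then v ⟨t, h⟩ else 0
  let V' : Fin 5 → MvPolynomial (Fin 4 × Fin 4) K := fun t => if h : (t : ℕ) < b then v' ⟨t, h⟩ else 0
  have hsum : ∑ t, V t * V' t = ∑ s, v s * v' s := by
    let f : ℕ → MvPolynomial (Fin 4 × Fin 4) K := fun n => if h : n < b then v ⟨n, h⟩ * v' ⟨n, h⟩ else 0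
    have h5 : ∑ t : Fin 5, V t * V' t = ∑ n ∈ Finset.range 5, f n := by
      rw [← Fin.sum_univ_eq_sum_range]
      refine Finset.sum_congr rfl fun t _ => ?_
      simp only [V, V', f]
      split_ifs <;> simp
    have hb' : ∑ s : Fin b, v s * v' s = ∑ n ∈ Finset.range b, f n := by
      rw [← Fin.sum_univ_eq_sum_range]
      refine Finset.sum_congr rfl fun s _ => ?_
      simp only [f, dif_pos s.isLt]
    rw [h5, hb']
    refine (Finset.sum_subset (Finset.range_subset_range.2 hb) fun n hn hnb => ?_).symm
    simp only [f, Finset.mem_range] at hnb ⊢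
    rw [dif_neg hnb]
  refine caseA_five_of_section_facts θ hθ1 hθ0 hθ3 hθc μ ν μ' ν' α u u' β hθlam hθlam' hnd q hq₀ hq₁
    hq₂ hq0 hF1 hF2 hF3 V V' (fun t => ?_) (fun t => ?_) (fun t => ?_) (fun t => ?_)
    (by rw [hsum]; exact hper)
  all_goals simp only [V, V']
  all_goals split_ifs
  exacts [hv _, Ideal.zero_mem _, hv2 _, isHomogeneous_zero _ _ _, hv' _, Ideal.zero_mem _, hv'2 _,
    isHomogeneous_zero _ _ _]

end Summit.ValiantsHypothesis.LiftNullstellensatz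

end
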